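import Summits.CriticalPhenomena.PercolationContinuityZ3.Theorems.PercNearOneGluingNoHeavyQuantDeepLowsGiants
import Summits.CriticalPhenomena.PercolationContinuityZ3.Theorems.PercNearOneGluingNoHeavyQuantWindowMix
import HarnessLib

/-!
# QUANT lane R8, T-DEC, leg (III): `LawDec.WindowMixDEC` (CW) AT EVERY DOMINANT LAYER `2j < S + ag(1−z)`, IN ITS OWN BINDER —
# from DEC of `ν` at the TWO window layers `j` and `⌈S−j⌉−1` (no top-affordability, no datum of the mixture)

builds on p205010 (kernel theorem, internal audit signed; external expert review pending)

Support file (`--supports stmt-CriticalPhenomena-4575`), QUANT lane seat prim-quant-arm-2 (gen 34), rung R8 of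
`run/shared/lean/prim/quant/LADDER.md`.  Theorems only (no definitions), standard axioms, no sorries.

WHAT.  `LawDec.WindowMixDEC` (lead g31, `…QuantWindowMix`; the statement of record for the blob case of leg (III), README V318–V321) asks:
`ν` a probability law on `{0..M}` (mean `S`), `0 ≤ z ≤ ν 0`, `g ≤ 1`, `y ≤ (1−z)g`, `1 ≤ a`, `ν` DEC at `(y, S, i)` for every window layer
`i ∈ [j−a, j]` ⟹ the mixture `P = (1−g)·ν + g·shiftBut ν a z` is DEC at `(y, S + ag(1−z), j)`.  Its docstring lists the dominant layers
`2j < S + ag(1−z)` as KNOWN by this seat's `gateConv_blob_decAt_dominant` — which, however, assumes `ν` DEC at EVERY layer.  This file proves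
the dominant layers IN THE CW BINDER ITSELF, and from less: **`windowMixDEC_dominant`** uses DEC of `ν` at the layer `j` and at the ONE
dominant window layer `n − 1`, `n = ⌈S − j⌉` (both in `[j−a, j]`), no top-affordability, no `j < M + a`.

PROOF (`windowMix_tail_ge_dominant`; at a dominant layer DEC is the far row, `decAt_of_tail_ge`).  `P{> j} = (1−g)·ν{> j} + g·ν{> j−a}`
(`g(1−z)` in place of the second term if `j < a`, and then `P{>j} ≥ g(1−z) ≥ y`).  If `2j < S`: both tails are `≥ y` (far row of `ν` at `j`).
Else `S ≤ 2j < S + ag(1−z) ≤ S + a` forces `j − a < S − j ≤ j`, so `n − 1 ∈ [j−a, j]` and `2(n−1) < S`; with `D = ν{≤ n−1}`: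
the two-layer giant bound of `ν` at `(j, n−1)` (`j + (n−1) < S`; `deepLows_le_giants_T`, DEC at layer `j` only) gives `(1−y)·ν{>j} ≥ y·D`,
the far row at `n−1` gives `D ≤ 1 − y`, and `ν{> j−a} ≥ 1 − D` (`j − a ≤ n − 1`); hence
`(1−y)·P{>j} ≥ (1−g)·y·D + g(1−y)(1−D) = (1−y)·y + (g − y)(1 − y − D) ≥ (1−y)·y`.

* `LawDec.deepLows_le_giants_T` — the two-layer giant bound `y·μ{≤ i′} ≤ (1−y)·μ{> i}` (`i′ ≤ i`, `i + i′ < T`) from `DECAtT y T i M μ` ALONE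
  (the single-layer, explicit-target form of `deepLows_le_giants`).
* **`LawDec.windowMix_tail_ge_dominant`** — the far row of the mixture at every `2j < S + ag(1−z)`.
* **`LawDec.windowMixDEC_dominant`** — the conclusion of `WindowMixDEC` at every dominant layer, CW binder (mean hypothesis for the target only).
HONEST STATUS: CW at the NON-dominant layers, `GateMove`, `SingleGateConvClosed`, `ConvClosedT` (non-dominant), `TreeDEC`, `FarTreeRow` remain OPEN;
the RATE class log\* and the honest sentence of `run/shared/lean/prim/quant/README.md` are unchanged.

[this work]; CW: prim-quant-lead g28–g31, FOR-PROVERS-CW.md (this lane).  Nothing here is cited as a published result.  The gluing rows served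
[cite: KozmaNitzan2024, Conjecture 3 (p. 15)]; product measure [cite: Grimmett1999, §1.3 p. 10].
-/

noncomputable section

namespace Summit.CriticalPhenomena.PercolationContinuityZ3.Theorems

namespace Quant

open Finset

/-- the mass of `μ` (a law on `{0..M}`) strictly above the layer `a` -/
local notation3 "TAIL[" μ ", " M ", " a "]" =>
  ∑ h ∈ Finset.range ((M : ℕ) + 1), (if (a : ℕ) + 1 ≤ h then (μ : ℕ → ℝ) h else 0)

/-- the mass of `μ` (a law on `{0..M}`) at or below the layer `a` -/
local notation3 "LOW[" μ ", " M ", " a "]" =>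
  ∑ h ∈ Finset.range ((M : ℕ) + 1), (if h ≤ (a : ℕ) then (μ : ℕ → ℝ) h else 0)

namespace LawDec

/-! ### The two-layer giant bound from ONE layer at an explicit target -/

/-- **DEEP LOWS RIDE ON THE GIANTS, single-layer form.**  If `μ` is `DECAtT y T i M μ` (`0 < y < 1`) and `i′ ≤ i`, `i + i′ < T`, then
`y·μ{h ≤ i′} ≤ (1−y)·μ{h > i}`: in a flow witness of DEC(i) at target `T` every atom `l ≤ i′` is a low with no compatible mid `≤ i`
(`l + m ≤ i′ + i < T`), so it rides on the giants `h > i` at rate `y/(1−y)`. [this work] -/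
theorem deepLows_le_giants_T (y T : ℝ) (M i i' : ℕ) (μ : ℕ → ℝ) (hy0 : 0 < y) (hy1 : y < 1)
    (hdec : DECAtT y T i M μ) (hii : i' ≤ i) (hdeep : (i : ℝ) + i' < T) :
    y * LOW[μ, M, i'] ≤ (1 - y) * TAIL[μ, M, i] := by
  classical
  have h1y : 0 < 1 - y := by linarith
  obtain ⟨f, hf0, hsupp, hrow, hcol⟩ := flowAtT_of_decAtT y T i M μ hy0 hy1 hdec
  -- atoms at or below `i′` are lows of layer `i` and ride only on giants
  have hlow : ∀ l, l ≤ i' → l ≤ i ∧ 2 * (l : ℝ) < T := by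
    intro l hl
    refine ⟨hl.trans hii, ?_⟩
    have e1 : (l : ℝ) ≤ i' := by exact_mod_cast hl
    have e2 : (i' : ℝ) ≤ i := by exact_mod_cast hii
    linarith
  have hgiant : ∀ l h, l ≤ i' → 0 < f l h → i + 1 ≤ h := by
    intro l h hl hpos
    obtain ⟨_, _, _, habs⟩ := hsupp l h hpos
    rcases habs with hg | hm
    · exact hg
    · by_contra hc
      have e1 : (h : ℝ) ≤ i := by exact_mod_cast (by omega : h ≤ i)
      have e2 : (l : ℝ) ≤ i' := by exact_mod_cast hl
      linarith
  -- the mass at or below `i′`, as giant-routed flow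
  have hmass : ∀ l ∈ Finset.range (M + 1), (if l ≤ i' then μ l else 0)
      = ∑ h ∈ Finset.range (M + 1), (if i + 1 ≤ h then (if l ≤ i' then f l h else 0) else 0) := by
    intro l _
    by_cases hl : l ≤ i'
    · rw [if_pos hl, ← hrow l (hlow l hl).1 (hlow l hl).2]
      refine Finset.sum_congr rfl fun h _ => ?_
      rw [if_pos hl]
      by_cases hg : i + 1 ≤ h
      · rw [if_pos hg]
      · rw [if_neg hg]
        rcases (hf0 l h).eq_or_lt with hz | hpos
        · exact hz.symm
        · exact absurd (hgiant l h hl hpos) hg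
    · rw [if_neg hl]
      symm
      refine Finset.sum_eq_zero fun h _ => ?_
      rw [if_neg hl]; split_ifs <;> rfl
  -- the giants carry it at rate `y/(1−y)`
  have hcap : ∀ h ∈ Finset.range (M + 1), y * ∑ l ∈ Finset.range (M + 1), (if i + 1 ≤ h then (if l ≤ i' then f l h else 0) else 0)
      ≤ (1 - y) * (if i + 1 ≤ h then μ h else 0) := by
    intro h hh
    rw [Finset.mem_range] at hh
    by_cases hg : i + 1 ≤ h
    · simp only [if_pos hg]
      have hc := hcol h (by omega) (Or.inl hg)
      have hu : ∀ l ∈ Finset.range (i + 1), usage y T i l h * f l h = y / (1 - y) * f l h :=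
        fun l _ => by rw [usage_giant_eq _ _ _ _ _ hg]
      rw [Finset.sum_congr rfl hu, ← Finset.mul_sum] at hc
      have hsub : ∑ l ∈ Finset.range (M + 1), (if l ≤ i' then f l h else 0) ≤ ∑ l ∈ Finset.range (i + 1), f l h := by
        rw [← Finset.sum_filter]
        refine Finset.sum_le_sum_of_subset_of_nonneg (fun l hl => ?_) (fun l _ _ => hf0 l h)
        rw [Finset.mem_filter, Finset.mem_range] at hl
        exact Finset.mem_range.2 (by omega)
      have hmul : y / (1 - y) * ∑ l ∈ Finset.range (M + 1), (if l ≤ i' then f l h else 0) ≤ μ h :=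
        (mul_le_mul_of_nonneg_left hsub (div_nonneg hy0.le h1y.le)).trans hc
      rw [div_mul_eq_mul_div, div_le_iff₀ h1y] at hmul
      linarith
    · simp only [if_neg hg]
      rw [Finset.sum_const_zero, mul_zero, mul_zero]
  calc y * LOW[μ, M, i']
      = y * ∑ l ∈ Finset.range (M + 1), ∑ h ∈ Finset.range (M + 1),
          (if i + 1 ≤ h then (if l ≤ i' then f l h else 0) else 0) := by rw [Finset.sum_congr rfl hmass]
    _ = ∑ h ∈ Finset.range (M + 1), y * ∑ l ∈ Finset.range (M + 1),
          (if i + 1 ≤ h then (if l ≤ i' then f l h else 0) else 0) := by rw [Finset.sum_comm, Finset.mul_sum]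
    _ ≤ ∑ h ∈ Finset.range (M + 1), (1 - y) * (if i + 1 ≤ h then μ h else 0) := Finset.sum_le_sum hcap
    _ = (1 - y) * TAIL[μ, M, i] := by rw [← Finset.mul_sum]

/-! ### CW at the dominant layers -/

/-- **THE FAR ROW OF THE WINDOW MIX AT EVERY DOMINANT LAYER.**  `0 < y < 1`, `0 ≤ z ≤ ν 0`, `g ≤ 1`, `y ≤ (1−z)g`, `1 ≤ a`; `ν ≥ 0` a
probability law on `{0..M}`; `ν` is `DECAtT y S i M ν` at every window layer `i ∈ [j−a, j]` (used: `i = j` and `i = ⌈S−j⌉−1`);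
`2j < S + ag(1−z)`.  Then `y ≤ Σ_{j < h ≤ M+a} ((1−g)·ν h + g·shiftBut ν a z h)`. [this work] -/
theorem windowMix_tail_ge_dominant (y z g S : ℝ) (a j M : ℕ) (ν : ℕ → ℝ)
    (hy0 : 0 < y) (hy1 : y < 1) (hz0 : 0 ≤ z) (hzν : z ≤ ν 0) (hg1 : g ≤ 1) (hyg : y ≤ (1 - z) * g) (ha : 1 ≤ a)
    (hν0 : ∀ h, 0 ≤ ν h) (hνM : ∀ h, M < h → ν h = 0) (hν1 : ∑ h ∈ Finset.range (M + 1), ν h = 1)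
    (hwin : ∀ i, j ≤ i + a → i ≤ j → DECAtT y S i M ν) (hdom : 2 * (j : ℝ) < S + (a : ℝ) * g * (1 - z)) :
    y ≤ ∑ h ∈ Finset.Ico (j + 1) (M + a + 1), ((1 - g) * ν h + g * shiftBut ν a z h) := by
  classical
  have h1y : 0 < 1 - y := by linarith
  have hν01 : ν 0 ≤ 1 := by
    rw [← hν1]
    exact Finset.single_le_sum (fun h _ => hν0 h) (Finset.mem_range.2 (Nat.succ_pos M))
  have hz1 : z ≤ 1 := hzν.trans hν01
  have hg0 : 0 ≤ g := by
    by_contra hc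
    have : (1 - z) * g ≤ 0 := mul_nonpos_of_nonneg_of_nonpos (by linarith) (not_le.1 hc).le
    linarith
  have hgy : y ≤ g := hyg.trans (by nlinarith)
  have hgz1 : g * (1 - z) ≤ 1 := by nlinarith
  have hT0 : ∀ b : ℕ, 0 ≤ TAIL[ν, M, b] := fun b => Finset.sum_nonneg fun h _ => by split_ifs; exacts [hν0 h, le_rfl]
  -- the tails of the two copies
  have hX : ∑ h ∈ Finset.Ico (j + 1) (M + a + 1), ν h = TAIL[ν, M, j] := by
    rw [sum_Ico_eq_sum_ite (M + a) j ν]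
    symm
    refine Finset.sum_subset (fun h hh => Finset.mem_range.2 (by have := Finset.mem_range.1 hh; omega)) fun h _ hnot => ?_
    have hgt : M < h := by
      by_contra hc
      exact hnot (Finset.mem_range.2 (by omega))
    rw [hνM h hgt]
    split_ifs <;> rfl
  have hsplit : ∑ h ∈ Finset.Ico (j + 1) (M + a + 1), ((1 - g) * ν h + g * shiftBut ν a z h)
      = (1 - g) * ∑ h ∈ Finset.Ico (j + 1) (M + a + 1), ν h + g * ∑ h ∈ Finset.Ico (j + 1) (M + a + 1), shiftBut ν a z h := by
    rw [Finset.sum_add_distrib, Finset.mul_sum, Finset.mul_sum]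
  rw [hsplit, hX]
  by_cases hja : j < a
  · -- below the blob: the shifted copy sits above `j` entirely (but for `z`)
    obtain ⟨_, _, _, w4⟩ := shiftBut_laws ν a M z ha hz0 hzν hν0 hνM hν1
    rw [w4 j hja]
    nlinarith [mul_nonneg (by linarith : (0 : ℝ) ≤ 1 - g) (hT0 j)]
  · have hja' : a ≤ j := not_lt.1 hja
    -- the shifted copy's tail above `j` is `ν{> j − a}`
    have hY : ∑ h ∈ Finset.Ico (j + 1) (M + a + 1), shiftBut ν a z h = TAIL[ν, M, j - a] := by
      have e1 : ∀ h ∈ Finset.Ico (j + 1) (M + a + 1), shiftBut ν a z h = ν (h - a) := by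
        intro h hh
        have hh1 := (Finset.mem_Ico.1 hh).1
        simp only [shiftBut]
        rw [if_neg (by omega : h ≠ 0), if_pos (by omega : a ≤ h), if_neg (by omega : h ≠ a)]
        ring
      rw [Finset.sum_congr rfl e1, Finset.sum_Ico_eq_sum_range, ← sum_Ico_eq_sum_ite M (j - a) ν, Finset.sum_Ico_eq_sum_range,
        show M + a + 1 - (j + 1) = M + 1 - (j - a + 1) by omega]
      exact Finset.sum_congr rfl fun k _ => by congr 1; omega
    rw [hY]
    by_cases hdomj : 2 * (j : ℝ) < S
    · -- `j` is dominant for `ν` itself: both tails are `≥ y`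
      have hrow := deepLows_le_giants_T y S M j j ν hy0 hy1 (hwin j (by omega) le_rfl) le_rfl (by linarith)
      have hs := sum_le_add_sum_gt M j ν
      rw [hν1] at hs
      have hanti : TAIL[ν, M, j] ≤ TAIL[ν, M, j - a] := sum_gt_antitone M j (j - a) ν hν0 (Nat.sub_le j a)
      nlinarith [mul_nonneg (by linarith : (0 : ℝ) ≤ 1 - g) (by nlinarith : (0 : ℝ) ≤ TAIL[ν, M, j] - y),
        mul_nonneg hg0 (by nlinarith : (0 : ℝ) ≤ TAIL[ν, M, j - a] - y)]
    · have hdomj' : S ≤ 2 * (j : ℝ) := not_lt.1 hdomj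
      have hja'' : (a : ℝ) ≤ j := by exact_mod_cast hja'
      have h2ja : 2 * (j : ℝ) - a < S := by nlinarith
      have hSj : (j : ℝ) < S := by linarith
      -- the dominant window layer `n − 1`, `n = ⌈S − j⌉`
      set n : ℕ := ⌈S - (j : ℝ)⌉₊ with hn
      have hn0 : 0 < n := Nat.ceil_pos.2 (by linarith)
      have hn1 : (((n - 1 : ℕ) : ℝ)) < S - j := by
        have : n - 1 < n := by omega
        rw [hn] at this
        exact (Nat.lt_ceil).1 this
      have hn2 : S - (j : ℝ) ≤ n := Nat.le_ceil _
      have hw1 : n - 1 ≤ j := by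
        have : (((n - 1 : ℕ) : ℝ)) < j := by linarith
        exact_mod_cast this.le
      have hw2 : j ≤ n - 1 + a := by
        have h1 : (j : ℝ) < n + a := by linarith
        have h2 : j < n + a := by exact_mod_cast h1
        omega
      have hB := deepLows_le_giants_T y S M j (n - 1) ν hy0 hy1 (hwin j (by omega) le_rfl) hw1 (by linarith)
      have hR := deepLows_le_giants_T y S M (n - 1) (n - 1) ν hy0 hy1 (hwin (n - 1) hw2 hw1) le_rfl (by linarith)
      have hs1 := sum_le_add_sum_gt M (n - 1) ν
      rw [hν1] at hs1
      have hs2 := sum_le_add_sum_gt M (j - a) ν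
      rw [hν1] at hs2
      have hD : LOW[ν, M, n - 1] ≤ 1 - y := by nlinarith
      have hmono : LOW[ν, M, j - a] ≤ LOW[ν, M, n - 1] := Finset.sum_le_sum fun h _ => by
        by_cases h1 : h ≤ j - a
        · rw [if_pos h1, if_pos (by omega)]
        · rw [if_neg h1]; split_ifs; exacts [hν0 h, le_rfl]
      have p1 : (1 - g) * (y * LOW[ν, M, n - 1]) ≤ (1 - g) * ((1 - y) * TAIL[ν, M, j]) :=
        mul_le_mul_of_nonneg_left hB (by linarith)
      have p2 : 0 ≤ (g - y) * (1 - y - LOW[ν, M, n - 1]) := mul_nonneg (by linarith) (by linarith)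
      have p3 : 1 - LOW[ν, M, n - 1] ≤ TAIL[ν, M, j - a] := by linarith
      have p4 : g * ((1 - y) * (1 - LOW[ν, M, n - 1])) ≤ g * ((1 - y) * TAIL[ν, M, j - a]) :=
        mul_le_mul_of_nonneg_left (mul_le_mul_of_nonneg_left p3 h1y.le) hg0
      have key : (1 - y) * y ≤ (1 - y) * ((1 - g) * TAIL[ν, M, j] + g * TAIL[ν, M, j - a]) := by linarith
      exact le_of_mul_le_mul_left key h1y

/-- **`WindowMixDEC` (CW) AT EVERY DOMINANT LAYER, in its own binder.**  `0 < y < 1`, `0 ≤ z ≤ ν 0`, `g ≤ 1`, `y ≤ (1−z)g`, `1 ≤ a`;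
`ν ≥ 0` a probability law on `{0..M}` with mean `S`; `ν` is `DECAtT y S i M ν` at every window layer `i ∈ [j−a, j]`; `2j < S + ag(1−z)`.
Then `(1−g)·ν + g·shiftBut ν a z` is `DECAtT y (S + ag(1−z)) j (M + a)` — the conclusion of `LawDec.WindowMixDEC` at the layer `j`
(no top-affordability and no `j < M + a` needed; of the window only the layers `j` and `⌈S−j⌉−1` are used). [this work] -/
theorem windowMixDEC_dominant (y z g S : ℝ) (a j M : ℕ) (ν : ℕ → ℝ)
    (hy0 : 0 < y) (hy1 : y < 1) (hz0 : 0 ≤ z) (hzν : z ≤ ν 0) (hg1 : g ≤ 1) (hyg : y ≤ (1 - z) * g) (ha : 1 ≤ a)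
    (hν0 : ∀ h, 0 ≤ ν h) (hνM : ∀ h, M < h → ν h = 0) (hν1 : ∑ h ∈ Finset.range (M + 1), ν h = 1)
    (hS : S = ∑ h ∈ Finset.range (M + 1), (h : ℝ) * ν h)
    (hwin : ∀ i, j ≤ i + a → i ≤ j → DECAtT y S i M ν) (hdom : 2 * (j : ℝ) < S + (a : ℝ) * g * (1 - z)) :
    DECAtT y (S + (a : ℝ) * g * (1 - z)) j (M + a) (fun h => (1 - g) * ν h + g * shiftBut ν a z h) := by
  have hν01 : ν 0 ≤ 1 := by
    rw [← hν1]
    exact Finset.single_le_sum (fun h _ => hν0 h) (Finset.mem_range.2 (Nat.succ_pos M))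
  have hg0 : 0 ≤ g := by
    by_contra hc
    have : (1 - z) * g ≤ 0 := mul_nonpos_of_nonneg_of_nonpos (by linarith) (not_le.1 hc).le
    linarith
  obtain ⟨p0, pM, p1, pmean⟩ := windowMix_laws ν a M g z ha hz0 hzν hg0 hg1 hν0 hνM hν1
  have h := decAt_of_tail_ge (M + a) (fun h => (1 - g) * ν h + g * shiftBut ν a z h) p0 pM p1 y j hy0
    (windowMix_tail_ge_dominant y z g S a j M ν hy0 hy1 hz0 hzν hg1 hyg ha hν0 hνM hν1 hwin hdom)
  have hmean : ∑ h ∈ Finset.range (M + a + 1), (h : ℝ) * ((1 - g) * ν h + g * shiftBut ν a z h) = S + (a : ℝ) * g * (1 - z) := by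
    rw [pmean, hS]
  simp only [decAt_iff_decAtT, hmean] at h
  exact h

end LawDec

end Quant

end Summit.CriticalPhenomena.PercolationContinuityZ3.Theorems
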